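import Literature.NumberTheory.LFunctions.FordLargeLambdaCheck
import Literature.NumberTheory.LFunctions.FordLargeLambdaCore2
import HarnessLib

/-!
# Soundness of the §5 row checker against Theorem 4' and the `θ'`-rows of (1.7)

Topic `Literature/NumberTheory/LFunctions`.  One small `def` (`FordVK.Sec5Row.thetaN2`, the
table of exponents `θ'` actually certified by the tree's PROGRAM-1 run for `k ≤ 1190`:
`2.3296 / 2.3856 / 2.4191` for the printed `2.3291 / 2.3849 / 2.4183` of [Ford2002, (1.7)]) and one
theorem:

* `FordVK.Sec5Row.sound2` — `check R = true` and `k² ≤ 120 s` give Theorem 2 of the source with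
  constant `10.031 = 1.06 · 9.463` on the `λ`-interval of the row (nontrivial range), from the rows
  of (1.7) at `θ'` (hypotheses `hT3a–c`, the shapes of `FordTheorem3Rows.lean`) and Theorem 4'
  (hypothesis `hT4'`, the shape of `FordVK.ford_theorem4_lib`).

The proof is that of `FordVK.Sec5Row.sound` (`FordLargeLambdaCheck.lean`) with
`FordVK.sec5_interval2` (`FordLargeLambdaCore2.lean`) in place of `FordVK.sec5_interval`; the
kernel-checked rows of `FordLargeLambdaRows*.lean` are reused unchanged.

## References
* K. Ford, Proc. London Math. Soc. (3) 85 (2002), 565–633; arXiv:1910.08209: §5, Theorem 2,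
  Lemmas 5.2–5.3 (Program 2), (1.7). [Ford2002]
-/

noncomputable section

open Finset Real

namespace Literature.NumberTheory.LFunctions
namespace FordVK
namespace Sec5Row

open RExpr VMV

/-- The numerator of `θ'` (denominator `10000`): the exponent of the row of (1.7) used for `k`
as certified by the tree (`FordTheorem3Rows.lean`; printed values `23291/23849/24183`).
[cite: Ford2002, (1.7)] -/
def thetaN2 (k : ℕ) : ℕ := if 200 ≤ k then 23296 else if 150 ≤ k then 23856 else 24191

variable (R : Sec5Row)

/-- **Soundness of the row checker against Theorem 4' and the `θ'`-rows**: `check R = true` and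
`k² ≤ 120 s` give Theorem 2 with constant `10.031` on the `λ`-interval of the row in the nontrivial
range, from the rows of (1.7) at `θ'` (`hT3a–c`) and Theorem 4' (`hT4'`).
[cite: Ford2002, proofs of Lemmas 5.2–5.3] -/
theorem sound2 (hc : R.check = true) (hks : R.k ^ 2 ≤ 120 * R.s)
    (hT3a : ∀ k : ℕ, 200 ≤ k → ∃ s₃ : ℕ, 1 ≤ s₃ ∧ (s₃ : ℝ) ≤ 3.21432 * (k : ℝ) ^ 2 ∧ ∀ P : ℕ, 1 ≤ P →
      (VMV.J k s₃ (Finset.Icc (1 : ℤ) P) : ℝ) ≤ (k : ℝ) ^ (2.3296 * (k : ℝ) ^ 3)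
        * (P : ℝ) ^ ((2 * s₃ : ℝ) - ((k * (k + 1) / 2 : ℕ) : ℝ) + 0.001 * (k : ℝ) ^ 2))
    (hT3b : ∀ k : ℕ, 150 ≤ k → k ≤ 199 → ∃ s₃ : ℕ, 1 ≤ s₃ ∧ (s₃ : ℝ) ≤ 3.21734 * (k : ℝ) ^ 2 ∧ ∀ P : ℕ, 1 ≤ P →
      (VMV.J k s₃ (Finset.Icc (1 : ℤ) P) : ℝ) ≤ (k : ℝ) ^ (2.3856 * (k : ℝ) ^ 3)
        * (P : ℝ) ^ ((2 * s₃ : ℝ) - ((k * (k + 1) / 2 : ℕ) : ℝ) + 0.001 * (k : ℝ) ^ 2))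
    (hT3c : ∀ k : ℕ, 129 ≤ k → k ≤ 149 → ∃ s₃ : ℕ, 1 ≤ s₃ ∧ (s₃ : ℝ) ≤ 3.22313 * (k : ℝ) ^ 2 ∧ ∀ P : ℕ, 1 ≤ P →
      (VMV.J k s₃ (Finset.Icc (1 : ℤ) P) : ℝ) ≤ (k : ℝ) ^ (2.4191 * (k : ℝ) ^ 3)
        * (P : ℝ) ^ ((2 * s₃ : ℝ) - ((k * (k + 1) / 2 : ℕ) : ℝ) + 0.001 * (k : ℝ) ^ 2))
    (hT4' : ∀ (k h s : ℕ) (P η D : ℝ), 60 ≤ k → (0.9 : ℝ) * k ≤ h → h + 2 ≤ k →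
      2 * (k - h + 1) ≤ s → s ≤ (h / 2) * (k - h + 1) → 10 ≤ D → Real.exp (D * (k : ℝ) ^ 2) ≤ P →
      2 / (k : ℝ) ^ 3 < η → η ≤ 1 / (2 * (k : ℝ)) →
      18 / (k : ℝ) ≤ 4 * Real.log k / (D * (k : ℝ) ^ 2 * η) →
      4 * Real.log k / (D * (k : ℝ) ^ 2 * η) ≤ 0.4 → 80 ≤ η * Real.log P →
      (Jinc k s ((calC P (P ^ η)).map Nat.castEmbedding) h k : ℝ)
        ≤ Real.exp ((s : ℝ) ^ 2 / ((k : ℝ) - h + 1)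
            + 10.5 * ((k : ℝ) - h + 1) * Real.log k ^ 2 / (D * k * η ^ 2)
            - s * ((1 / η + h) * (1 - 1 / (h : ℝ)) ^ ((s : ℝ) / ((k : ℝ) - h + 1)) - h)
              * Real.log (1 / (12 * η)))
          * P ^ ((2 * s : ℝ) - ((k : ℝ) - h + 1) / 2 * (h + k) + ((k : ℝ) - h + 1) * ((k : ℝ) - h) / 2
            + η * (s : ℝ) ^ 2 / (2 * ((k : ℝ) - h + 1))
            + h * ((k : ℝ) - h + 1) * Real.exp (-(s : ℝ) / (h * ((k : ℝ) - h + 1)))))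
    {N R₀ : ℕ} {t u : ℝ} (hN : 2 ≤ N) (hNR : N < R₀) (hR : R₀ ≤ 2 * N) (hu0 : 0 < u) (hu1 : u ≤ 1)
    (ht0 : 0 < t) (hlo : (R.lamloN : ℝ) / R.lamD * Real.log N ≤ Real.log t)
    (hhi : Real.log t ≤ (R.lamhiN : ℝ) / R.lamD * Real.log N)
    (hbig : 300 * (Real.log t / Real.log N) ^ 2 ≤ Real.log N) :
    ‖∑ n ∈ Ioc N R₀, ((n : ℂ) + u) ^ (-(t * Complex.I))‖
      ≤ 10.031 * (N : ℝ) ^ (1 - Real.log N ^ 2 / (133.66 * Real.log t ^ 2)) := by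
  -- unpack the checker
  simp only [check, Bool.and_eq_true, decide_eq_true_eq] at hc
  obtain ⟨⟨⟨⟨⟨⟨⟨⟨⟨⟨⟨hlamD, hetaN, hetaD, h87, hlohi, hk129⟩, hc1⟩, ⟨hc2a, hc2b, hc2c, hc2d, hc2e⟩⟩, hc3⟩,
    ⟨hc4a, hc4b⟩⟩, ⟨hc5a, hc5b, hc5c⟩⟩, ⟨hc6a, hc6b, hc6c, hc6d, hc6e, hc6f, hc6g⟩⟩, ⟨hc7a, hc7b, hc7c⟩⟩,
    h4cd⟩, h8⟩, h9⟩ := hc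
  -- the row of (1.7) at `k`
  have hT3 : ∃ s₃ : ℕ, 1 ≤ s₃ ∧ (s₃ : ℝ) ≤ ((rhoN R.k : ℕ) : ℝ) / 100000 * (R.k : ℝ) ^ 2 ∧ ∀ P : ℕ, 1 ≤ P →
      (VMV.J R.k s₃ (Finset.Icc (1 : ℤ) P) : ℝ) ≤ (R.k : ℝ) ^ (((thetaN2 R.k : ℕ) : ℝ) / 10000 * (R.k : ℝ) ^ 3)
        * (P : ℝ) ^ ((2 * s₃ : ℝ) - ((R.k * (R.k + 1) / 2 : ℕ) : ℝ) + 0.001 * (R.k : ℝ) ^ 2) := by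
    unfold rhoN thetaN2
    split_ifs with h200 h150
    · obtain ⟨s₃, h1, h2, h3⟩ := hT3a R.k h200
      refine ⟨s₃, h1, by norm_num; linarith [h2], fun P hP => ?_⟩
      have := h3 P hP; norm_num at this ⊢; exact this
    · obtain ⟨s₃, h1, h2, h3⟩ := hT3b R.k h150 (by omega)
      refine ⟨s₃, h1, by norm_num; linarith [h2], fun P hP => ?_⟩
      have := h3 P hP; norm_num at this ⊢; exact this
    · obtain ⟨s₃, h1, h2, h3⟩ := hT3c R.k hk129 (by omega)
      refine ⟨s₃, h1, by norm_num; linarith [h2], fun P hP => ?_⟩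
      have := h3 P hP; norm_num at this ⊢; exact this
  -- casts of the data
  have hlamD' : (0 : ℝ) < R.lamD := by exact_mod_cast hlamD
  have hetaN' : (0 : ℝ) < R.etaN := by exact_mod_cast hetaN
  have hetaD' : (0 : ℝ) < R.etaD := by exact_mod_cast hetaD
  have hhg : R.h ≤ R.g := by omega
  have hg0 : 0 < R.g := by omega
  have hh2 : 2 ≤ R.h := by omega
  have hs0 : 0 < R.s := by omega
  have hlamlo0 : 0 < R.lamloN := by
    have : 0 < 87 * R.lamD := by omega
    omega
  set lamlo : ℝ := (R.lamloN : ℝ) / R.lamD with hlamlo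
  set lamhi : ℝ := (R.lamhiN : ℝ) / R.lamD with hlamhi
  set η : ℝ := (R.etaN : ℝ) / R.etaD with hη
  have hηpos : 0 < η := by positivity
  -- the interval conditions
  have hS := S5_pos
  -- c4c, c4d
  have hc4 : 18 / (R.g : ℝ) ≤ 4 * Real.log R.g / (30.57 * (R.g : ℝ) ^ 2 * η)
      ∧ 4 * Real.log R.g / (30.57 * (R.g : ℝ) ^ 2 * η) ≤ 0.4 := by
    split at h4cd
    · rename_i Y hY
      simp only [decide_eq_true_eq] at h4cd
      rw [← R.val_e4 hg0 hetaN hetaD]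
      constructor
      · have := le_val_of_lo hS hY (p := 18) (q := R.g) hg0 (by exact_mod_cast h4cd.1)
        simpa using this
      · have := val_le_of_hi hS hY (p := 2) (q := 5) (by norm_num) (by exact_mod_cast h4cd.2)
        norm_num at this
        linarith
    · exact absurd h4cd (by simp)
  -- c8
  have hc8 : val R.e8 ≤ Real.log (9.463 - 0.002) := by
    split at h8
    · rename_i Y Z hY hZ
      simp only [decide_eq_true_eq] at h8
      have := val_le_val hS hY hZ h8
      refine this.trans (le_of_eq ?_)
      simp only [eCt, RExpr.val]
      rw [← Real.log_div (by norm_num) (by norm_num)]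
      norm_num
    · exact absurd h8 (by simp)
  -- c9
  have hc9 : val (R.e9 R.lamloN) ≤ 0 ∧ val (R.e9 R.lamhiN) ≤ 0 := by
    split at h9
    · rename_i Y Z hY hZ
      simp only [decide_eq_true_eq] at h9
      constructor
      · have := val_le_of_hi hS hY (p := 0) (q := 1) (by norm_num) h9.1
        simpa using this
      · have := val_le_of_hi hS hZ (p := 0) (q := 1) (by norm_num) h9.2
        simpa using this
    · exact absurd h9 (by simp)
  rw [R.val_e8 hhg hh2 hetaN hetaD hg0 hs0] at hc8
  rw [R.val_e9 hhg hetaD hlamlo0 hlamD hs0, R.val_e9 hhg hetaD hlamlo0 hlamD hs0] at hc9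
  -- apply the interval theorem
  refine (sec5_interval2 (k := R.k) (h := R.h) (g := R.g) (s := R.s) (m₁ := R.m₁) (m₂ := R.m₂) (wp := R.wp)
    (lamlo := lamlo) (lamhi := lamhi) (η := η) (ρ := ((rhoN R.k : ℕ) : ℝ) / 100000)
    (θ := ((thetaN R.k : ℕ) : ℝ) / 10000) (θ₁ := ((thetaN2 R.k : ℕ) : ℝ) / 10000) (Ctar := 9.463) hT3 hT4'
    ?_ ?_ hηpos (by norm_num) (by unfold thetaN thetaN2; split_ifs <;> norm_num)
    (by unfold rhoN; split_ifs <;> norm_num) hks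
    ?_ hc2a ?_ hc2c hc2d hc2e ?_ ?_ ?_ hc4.1 hc4.2 ?_ ?_ ?_ hc6a hc6b hc6c ?_ ?_ ?_ ?_
    ?_ hc7b hc7c ?_ ?_ hN hNR hR hu0 hu1 ht0 hlo hhi hbig).trans
    (mul_le_mul_of_nonneg_right (by norm_num) (by positivity))
  · -- c0
    rw [hlamlo, le_div_iff₀ hlamD']; exact_mod_cast h87
  · -- c0'
    rw [hlamlo, hlamhi]; exact div_le_div_of_nonneg_right (by exact_mod_cast hlohi) hlamD'.le
  · -- c1
    have : (10000000 * (R.lamhiN : ℝ) + 3508000 * R.lamD) ≤ 9999981 * R.lamD + 6492000 * R.k * R.lamD := by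
      exact_mod_cast hc1
    rw [hlamhi]
    rw [div_sub' (hc := hlamD'.ne'), div_add' _ _ _ hlamD'.ne', div_le_iff₀ hlamD']
    nlinarith only [this, hlamD']
  · -- c2b
    have : (9 : ℝ) * R.g ≤ 10 * R.h := by exact_mod_cast hc2b
    linarith
  · -- c3
    have : (3057 : ℝ) * R.g ^ 2 * R.lamD ^ 2 ≤ 4809 * R.lamloN ^ 2 := by exact_mod_cast hc3
    rw [hlamlo, div_pow]
    rw [show (0.1603 : ℝ) * 300 * ((R.lamloN : ℝ) ^ 2 / (R.lamD : ℝ) ^ 2)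
      = 48.09 * (R.lamloN : ℝ) ^ 2 / (R.lamD : ℝ) ^ 2 by ring, le_div_iff₀ (by positivity)]
    nlinarith only [this]
  · -- c4a
    have : (2 : ℝ) * R.etaD < R.etaN * R.g ^ 3 := by exact_mod_cast hc4a
    rw [hη, div_lt_div_iff₀ (by positivity) hetaD']
    nlinarith only [this]
  · -- c4b
    have : (2 : ℝ) * R.g * R.etaN ≤ R.etaD := by exact_mod_cast hc4b
    rw [hη, div_le_div_iff₀ hetaD' (by positivity)]
    nlinarith only [this]
  · -- c5a
    have : (8000 : ℝ) * R.etaD * R.lamD ^ 2 ≤ 4809 * R.etaN * R.lamloN ^ 2 := by exact_mod_cast hc5a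
    rw [hη, hlamlo, div_pow]
    rw [show (R.etaN : ℝ) / R.etaD * (0.1603 * 300 * ((R.lamloN : ℝ) ^ 2 / (R.lamD : ℝ) ^ 2))
      = 48.09 * R.etaN * (R.lamloN : ℝ) ^ 2 / (R.etaD * (R.lamD : ℝ) ^ 2) by field_simp; ring,
      le_div_iff₀ (by positivity)]
    nlinarith only [this]
  · -- c5b
    have : (2 : ℝ) * R.etaN ≤ R.etaD := by exact_mod_cast hc5b
    rw [hη, one_div_div, le_div_iff₀ hetaN']
    linarith
  · -- c5c
    have : (26 : ℝ) * R.etaD ≤ 25 * R.wp * R.etaN := by exact_mod_cast hc5c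
    rw [hη, one_div_div, show 26 * ((R.etaD : ℝ) / R.etaN) / 25 = 26 * R.etaD / (25 * R.etaN) by
      field_simp, div_le_iff₀ (by positivity)]
    nlinarith only [this]
  · -- c6d
    have : (R.m₂ : ℝ) * 8397 * R.lamD ≤ 10000 * R.lamloN := by exact_mod_cast hc6d
    rw [hlamlo, le_div_iff₀ hlamD']
    nlinarith only [this]
  · -- c6e
    have : (10000 : ℝ) * R.lamhiN ≤ (R.m₂ + 1) * 8397 * R.lamD := by exact_mod_cast hc6e
    rw [hlamhi, div_le_iff₀ hlamD']
    nlinarith only [this]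
  · -- c6f
    have : (R.m₁ : ℝ) * 8095 * R.lamD ≤ 10000 * R.lamloN := by exact_mod_cast hc6f
    rw [hlamlo, le_div_iff₀ hlamD']
    nlinarith only [this]
  · -- c6g
    have : (10000 : ℝ) * R.lamhiN ≤ (R.m₁ + 1) * 8095 * R.lamD := by exact_mod_cast hc6g
    rw [hlamhi, div_le_iff₀ hlamD']
    nlinarith only [this]
  · -- c7a
    rw [R.floor_rho_eq]; exact hc7a
  · -- c8
    rw [R.floor_rho_eq]; exact hc8
  · -- c9
    rw [R.floor_rho_eq]
    intro lstar hl
    rcases hl with rfl | rfl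
    · exact hc9.1
    · exact hc9.2

end Sec5Row
end FordVK
end Literature.NumberTheory.LFunctions
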